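import Summits.PneNP.PneNP.Theorems.KarlinRubinMonotoneSufficesGreedyDefs
import Summits.PneNP.PneNP.Theorems.KarlinRubinMonotoneSufficesCoverCount

/-!
# Crux `MonotoneSuffices` (stmt-PneNP-18026), the GREEDY general detector — part 8: hard-wiring the tables

The detector ORs `R` trials with candidate tables `cs : Fin R → (Fin t → Fin M → Fin n)`. This file chooses the
tables by AVERAGING over all `|Ω|^R` tuples of tables (`Ω` = all tables; the probabilistic method, as for the
covering family of the monotone detector): from the five per-`n` ingredients

* (H0) every trial accepts at most `2^{#E} e₀` null inputs (part 5),
* (H1) for every planted set `A`, the bad-noise inputs number at most `2^{#E} e_b` (part 6),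
* (H2) for every `A` and every good noise `z`, at least `s₀ |Ω|` tables run into `A` on `plant A z` (parts 2, 6),
* (H3) a trial whose candidates miss at least `a₀` vertices of `A` runs into `A` and yet rejects on at most
  `2^{#E} e₁` noise inputs (part 5),
* (H4) for every candidate-sized `W`, the planted sets with fewer than `a₀` vertices off `W` are at most an
  `e_h`-fraction (part 7),

it produces tables `cs` with
`#{x : det accepts x}·C(n,k) + Σ_A #{z : det rejects plant A z} ≤ C(n,k) 2^{#E} (R e₀ + (1-s₀)^R + e_b + R (e₁+e_h))`
(`exists_tables`), i.e. null error plus planted error `≤ 2 (R e₀ + (1-s₀)^R + e_b + R (e₁ + e_h))`.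
The key step is the double count `Σ_{cs} #{z : no trial runs into A} = Σ_z (|Ω| - #S_A(z))^R ≤ 2^{#E}|Ω|^R ((1-s₀)^R + e_b)`.
-/

set_option linter.dupNamespace false -- `Summit.PneNP.PneNP.…`: summit = sub-problem name (D-0017 single-conjunct layout)

namespace Summit.PneNP.PneNP.Theorems.MonotoneSuffices.Greedy

open Finset Real
open Literature.Probability.RandomGraphs.PlantedClique
open Summit.PneNP.PneNP.Theorems.MonotoneSuffices.Cover

variable {n t M R : ℕ}

/-! ### The detector's events in terms of the trials -/

/-- The detector accepts only if some trial accepts (union bound). [folklore] -/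
theorem card_detOut_le_sum (cs : Fin R → Fin t → Fin M → Fin n) (θ : ℕ) :
    #((univ : Finset (EdgeVec n)).filter fun x => detOut x cs θ = true) ≤
      ∑ r : Fin R, #((univ : Finset (EdgeVec n)).filter fun x => trialOut x (cs r) θ = true) := by
  classical
  refine le_trans (card_le_card fun x hx => ?_) card_biUnion_le
  rw [mem_filter] at hx
  obtain ⟨r, hr⟩ := (detOut_eq_true_iff x cs θ).1 hx.2
  exact mem_biUnion.2 ⟨r, mem_univ _, mem_filter.2 ⟨mem_univ _, hr⟩⟩

/-- The detector rejects the planted input only if no trial runs into `A`, or some trial runs into `A` and yet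
rejects. [folklore] -/
theorem card_not_detOut_le (cs : Fin R → Fin t → Fin M → Fin n) (θ : ℕ) (A : Finset (Fin n)) :
    #((univ : Finset (EdgeVec n)).filter fun z => detOut (plant A z) cs θ = false) ≤
      #((univ : Finset (EdgeVec n)).filter fun z => ∀ r, ¬ ∃ T ⊆ A, run (plant A z) (cs r) t = some T) +
        ∑ r : Fin R, #((univ : Finset (EdgeVec n)).filter fun z =>
          (∃ T ⊆ A, run (plant A z) (cs r) t = some T) ∧ trialOut (plant A z) (cs r) θ = false) := by
  classical
  refine le_trans (card_le_card fun z hz => ?_) ((card_union_le _ _).trans (Nat.add_le_add_left card_biUnion_le _))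
  rw [mem_filter] at hz
  have hno : ∀ r, trialOut (plant A z) (cs r) θ = false := by
    intro r
    cases h : trialOut (plant A z) (cs r) θ
    · rfl
    · have := (detOut_eq_true_iff (plant A z) cs θ).2 ⟨r, h⟩
      rw [this] at hz; exact absurd hz.2 (by decide)
  rw [mem_union, mem_filter, mem_biUnion]
  by_cases hex : ∃ r, ∃ T ⊆ A, run (plant A z) (cs r) t = some T
  · obtain ⟨r, hr⟩ := hex
    exact Or.inr ⟨r, mem_univ _, mem_filter.2 ⟨mem_univ _, hr, hno r⟩⟩
  · push Not at hex
    exact Or.inl ⟨mem_univ _, fun r h => by obtain ⟨T, hTA, hT⟩ := h; exact hex r T hTA hT⟩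

/-! ### The averaging -/

/-- Double counting the noise inputs into which no hard-wired trial runs. [folklore] -/
theorem sum_card_noRun_eq (A : Finset (Fin n)) (t M R : ℕ) :
    ∑ cs : Fin R → Fin t → Fin M → Fin n,
        #((univ : Finset (EdgeVec n)).filter fun z => ∀ r, ¬ ∃ T ⊆ A, run (plant A z) (cs r) t = some T) =
      ∑ z : EdgeVec n, (#((univ : Finset (Fin t → Fin M → Fin n)).filter fun ω =>
        ¬ ∃ T ⊆ A, run (plant A z) ω t = some T)) ^ R := by
  classical
  have h : ∀ z : EdgeVec n, (#((univ : Finset (Fin t → Fin M → Fin n)).filter fun ω =>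
      ¬ ∃ T ⊆ A, run (plant A z) ω t = some T)) ^ R =
      #((univ : Finset (Fin R → Fin t → Fin M → Fin n)).filter fun cs =>
        ∀ r, ¬ ∃ T ⊆ A, run (plant A z) (cs r) t = some T) := by
    intro z
    rw [← card_filter_piFinset_forall (univ : Finset (Fin t → Fin M → Fin n)) R
      (fun ω => ¬ ∃ T ⊆ A, run (plant A z) ω t = some T), Fintype.piFinset_univ]
  simp_rw [h, card_filter]
  exact sum_comm

/-- **Hard-wiring the tables.** See the module docstring for (H0)–(H4). [folklore] -/
theorem exists_tables (hn : 0 < n) (t M R θ k a₀ : ℕ) (Bad : Finset (Fin n) → EdgeVec n → Prop)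
    [∀ A, DecidablePred (Bad A)] {e₀ e_b e₁ e_h s₀ : ℝ} (he₁ : 0 ≤ e₁) (hs₀1 : s₀ ≤ 1)
    (H0 : ∀ ω : Fin t → Fin M → Fin n, (#((univ : Finset (EdgeVec n)).filter fun x => trialOut x ω θ = true) : ℝ) ≤
      2 ^ Fintype.card (⊤ : SimpleGraph (Fin n)).edgeSet * e₀)
    (H1 : ∀ A ∈ powersetCard k (univ : Finset (Fin n)), (#((univ : Finset (EdgeVec n)).filter (Bad A)) : ℝ) ≤
      2 ^ Fintype.card (⊤ : SimpleGraph (Fin n)).edgeSet * e_b)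
    (H2 : ∀ A ∈ powersetCard k (univ : Finset (Fin n)), ∀ z, ¬ Bad A z →
      s₀ * Fintype.card (Fin t → Fin M → Fin n) ≤
        #((univ : Finset (Fin t → Fin M → Fin n)).filter fun ω => ∃ T ⊆ A, run (plant A z) ω t = some T))
    (H3 : ∀ (ω : Fin t → Fin M → Fin n), ∀ A ∈ powersetCard k (univ : Finset (Fin n)), a₀ ≤ #(A \ candSet ω) →
      (#((univ : Finset (EdgeVec n)).filter fun z =>
        (∃ T ⊆ A, run (plant A z) ω t = some T) ∧ trialOut (plant A z) ω θ = false) : ℝ) ≤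
        2 ^ Fintype.card (⊤ : SimpleGraph (Fin n)).edgeSet * e₁)
    (H4 : ∀ W : Finset (Fin n), #W ≤ t * M →
      (#((powersetCard k (univ : Finset (Fin n))).filter fun A => #(A \ W) < a₀) : ℝ) ≤ (n.choose k : ℝ) * e_h) :
    ∃ cs : Fin R → Fin t → Fin M → Fin n,
      (#((univ : Finset (EdgeVec n)).filter fun x => detOut x cs θ = true) : ℝ) * n.choose k +
        ∑ A ∈ powersetCard k (univ : Finset (Fin n)),
          (#((univ : Finset (EdgeVec n)).filter fun z => detOut (plant A z) cs θ = false) : ℝ) ≤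
      (n.choose k : ℝ) * 2 ^ Fintype.card (⊤ : SimpleGraph (Fin n)).edgeSet *
        (R * e₀ + (1 - s₀) ^ R + e_b + R * (e₁ + e_h)) := by
  classical
  haveI : Nonempty (Fin n) := ⟨⟨0, hn⟩⟩
  -- notation
  set C : ℝ := (n.choose k : ℝ) with hC
  set P : ℝ := (2 : ℝ) ^ Fintype.card (⊤ : SimpleGraph (Fin n)).edgeSet with hP
  set N : ℝ := (Fintype.card (Fin t → Fin M → Fin n) : ℝ) with hN
  have hC0 : 0 ≤ C := Nat.cast_nonneg _
  have hP0 : 0 ≤ P := by positivity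
  have hN0 : 0 ≤ N := Nat.cast_nonneg _
  have hPcard : (Fintype.card (EdgeVec n) : ℝ) = P := by
    rw [hP, Fintype.card_fun, Fintype.card_bool]; push_cast; ring
  have hKcard : (#(powersetCard k (univ : Finset (Fin n))) : ℝ) = C := by
    rw [card_powersetCard, card_univ, Fintype.card_fin]
  have hcs_card : (#(univ : Finset (Fin R → Fin t → Fin M → Fin n)) : ℝ) = N ^ R := by
    rw [card_univ, Fintype.card_fun, Fintype.card_fin, hN]; push_cast; ring
  -- the quantity to average
  set Φ : (Fin R → Fin t → Fin M → Fin n) → ℝ := fun cs =>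
    (#((univ : Finset (EdgeVec n)).filter fun x => detOut x cs θ = true) : ℝ) * n.choose k +
      ∑ A ∈ powersetCard k (univ : Finset (Fin n)),
        (#((univ : Finset (EdgeVec n)).filter fun z => detOut (plant A z) cs θ = false) : ℝ) with hΦ
  suffices hsum : ∑ cs : Fin R → Fin t → Fin M → Fin n, Φ cs ≤
      ∑ _cs : Fin R → Fin t → Fin M → Fin n, C * P * (R * e₀ + (1 - s₀) ^ R + e_b + R * (e₁ + e_h)) by
    obtain ⟨cs, -, hcs⟩ := exists_le_of_sum_le univ_nonempty hsum
    exact ⟨cs, hcs⟩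
  -- (B) the null part
  have hB : ∀ cs : Fin R → Fin t → Fin M → Fin n,
      (#((univ : Finset (EdgeVec n)).filter fun x => detOut x cs θ = true) : ℝ) * n.choose k ≤ C * P * (R * e₀) := by
    intro cs
    have h1 : (#((univ : Finset (EdgeVec n)).filter fun x => detOut x cs θ = true) : ℝ) ≤
        ∑ r : Fin R, (#((univ : Finset (EdgeVec n)).filter fun x => trialOut x (cs r) θ = true) : ℝ) := by
      exact_mod_cast card_detOut_le_sum cs θ
    have h2 : ∑ r : Fin R, (#((univ : Finset (EdgeVec n)).filter fun x => trialOut x (cs r) θ = true) : ℝ) ≤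
        ∑ _r : Fin R, P * e₀ := sum_le_sum fun r _ => H0 (cs r)
    rw [sum_const, card_univ, Fintype.card_fin, nsmul_eq_mul] at h2
    rw [← hC]
    nlinarith [h1.trans h2]
  -- (D) no trial runs into `A`
  have hD : ∀ A ∈ powersetCard k (univ : Finset (Fin n)),
      ∑ cs : Fin R → Fin t → Fin M → Fin n,
        (#((univ : Finset (EdgeVec n)).filter fun z => ∀ r, ¬ ∃ T ⊆ A, run (plant A z) (cs r) t = some T) : ℝ) ≤
      P * N ^ R * ((1 - s₀) ^ R + e_b) := by
    intro A hA
    have heq := sum_card_noRun_eq (n := n) A t M R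
    have heq' : ∑ cs : Fin R → Fin t → Fin M → Fin n,
        (#((univ : Finset (EdgeVec n)).filter fun z => ∀ r, ¬ ∃ T ⊆ A, run (plant A z) (cs r) t = some T) : ℝ) =
        ∑ z : EdgeVec n, ((#((univ : Finset (Fin t → Fin M → Fin n)).filter fun ω =>
          ¬ ∃ T ⊆ A, run (plant A z) ω t = some T) : ℝ)) ^ R := by exact_mod_cast heq
    rw [heq']
    -- split by good / bad noise
    have hterm : ∀ z : EdgeVec n, ((#((univ : Finset (Fin t → Fin M → Fin n)).filter fun ω =>
        ¬ ∃ T ⊆ A, run (plant A z) ω t = some T) : ℝ)) ^ R ≤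
        (N * (1 - s₀)) ^ R + (if Bad A z then N ^ R else 0) := by
      intro z
      have hcompl : ((#((univ : Finset (Fin t → Fin M → Fin n)).filter fun ω =>
          ¬ ∃ T ⊆ A, run (plant A z) ω t = some T) : ℝ)) =
          N - #((univ : Finset (Fin t → Fin M → Fin n)).filter fun ω => ∃ T ⊆ A, run (plant A z) ω t = some T) := by
        have h := card_filter_add_card_filter_not (s := (univ : Finset (Fin t → Fin M → Fin n)))
          (fun ω => ∃ T ⊆ A, run (plant A z) ω t = some T)
        rw [card_univ] at h
        rw [hN]
        have h' : ((#((univ : Finset (Fin t → Fin M → Fin n)).filter fun ω => ∃ T ⊆ A, run (plant A z) ω t = some T) : ℕ) : ℝ) +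
            #((univ : Finset (Fin t → Fin M → Fin n)).filter fun ω => ¬ ∃ T ⊆ A, run (plant A z) ω t = some T) =
            Fintype.card (Fin t → Fin M → Fin n) := by exact_mod_cast h
        linarith
      have hle_N : ((#((univ : Finset (Fin t → Fin M → Fin n)).filter fun ω =>
          ¬ ∃ T ⊆ A, run (plant A z) ω t = some T) : ℝ)) ≤ N := by
        rw [hN]; exact_mod_cast card_le_univ _
      have h0 : (0 : ℝ) ≤ ((#((univ : Finset (Fin t → Fin M → Fin n)).filter fun ω =>
          ¬ ∃ T ⊆ A, run (plant A z) ω t = some T) : ℝ)) := Nat.cast_nonneg _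
      by_cases hbad : Bad A z
      · rw [if_pos hbad]
        have : ((#((univ : Finset (Fin t → Fin M → Fin n)).filter fun ω =>
            ¬ ∃ T ⊆ A, run (plant A z) ω t = some T) : ℝ)) ^ R ≤ N ^ R := pow_le_pow_left₀ h0 hle_N R
        have h2 : (0 : ℝ) ≤ (N * (1 - s₀)) ^ R := pow_nonneg (mul_nonneg hN0 (by linarith)) R
        linarith
      · rw [if_neg hbad, add_zero]
        refine pow_le_pow_left₀ h0 ?_ R
        rw [hcompl]
        have := H2 A hA z hbad
        nlinarith
    refine (sum_le_sum fun z _ => hterm z).trans ?_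
    rw [sum_add_distrib, sum_const, card_univ, nsmul_eq_mul, hPcard, ← sum_filter, sum_const, nsmul_eq_mul]
    have hbadcard : (#((univ : Finset (EdgeVec n)).filter (Bad A)) : ℝ) ≤ P * e_b := H1 A hA
    have hNR : (0 : ℝ) ≤ N ^ R := pow_nonneg hN0 R
    calc P * (N * (1 - s₀)) ^ R + #((univ : Finset (EdgeVec n)).filter (Bad A)) * N ^ R
        ≤ P * (N * (1 - s₀)) ^ R + (P * e_b) * N ^ R := by nlinarith
      _ = P * N ^ R * ((1 - s₀) ^ R + e_b) := by rw [mul_pow]; ring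
  -- (E) running into `A` and yet rejecting
  have hE : ∀ ω : Fin t → Fin M → Fin n,
      ∑ A ∈ powersetCard k (univ : Finset (Fin n)), (#((univ : Finset (EdgeVec n)).filter fun z =>
        (∃ T ⊆ A, run (plant A z) ω t = some T) ∧ trialOut (plant A z) ω θ = false) : ℝ) ≤ C * P * (e₁ + e_h) := by
    intro ω
    have hterm : ∀ A ∈ powersetCard k (univ : Finset (Fin n)), (#((univ : Finset (EdgeVec n)).filter fun z =>
        (∃ T ⊆ A, run (plant A z) ω t = some T) ∧ trialOut (plant A z) ω θ = false) : ℝ) ≤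
        P * e₁ + (if #(A \ candSet ω) < a₀ then P else 0) := by
      intro A hA
      by_cases ha : #(A \ candSet ω) < a₀
      · rw [if_pos ha]
        have h1 : (#((univ : Finset (EdgeVec n)).filter fun z =>
            (∃ T ⊆ A, run (plant A z) ω t = some T) ∧ trialOut (plant A z) ω θ = false) : ℝ) ≤ P := by
          rw [← hPcard]; exact_mod_cast card_le_univ _
        nlinarith
      · rw [if_neg ha, add_zero]
        exact H3 ω A hA (not_lt.1 ha)
    refine (sum_le_sum hterm).trans ?_
    rw [sum_add_distrib, sum_const, nsmul_eq_mul, hKcard, ← sum_filter, sum_const, nsmul_eq_mul]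
    have h4 := H4 (candSet ω) (card_candSet_le ω)
    nlinarith [mul_le_mul_of_nonneg_right h4 hP0]
  -- assemble
  have hΦle : ∀ cs : Fin R → Fin t → Fin M → Fin n, Φ cs ≤ C * P * (R * e₀) +
      (∑ A ∈ powersetCard k (univ : Finset (Fin n)),
        (#((univ : Finset (EdgeVec n)).filter fun z => ∀ r, ¬ ∃ T ⊆ A, run (plant A z) (cs r) t = some T) : ℝ)) +
      ∑ r : Fin R, ∑ A ∈ powersetCard k (univ : Finset (Fin n)), (#((univ : Finset (EdgeVec n)).filter fun z =>
        (∃ T ⊆ A, run (plant A z) (cs r) t = some T) ∧ trialOut (plant A z) (cs r) θ = false) : ℝ) := by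
    intro cs
    rw [hΦ]
    have hpl : ∑ A ∈ powersetCard k (univ : Finset (Fin n)),
        (#((univ : Finset (EdgeVec n)).filter fun z => detOut (plant A z) cs θ = false) : ℝ) ≤
        (∑ A ∈ powersetCard k (univ : Finset (Fin n)),
          (#((univ : Finset (EdgeVec n)).filter fun z => ∀ r, ¬ ∃ T ⊆ A, run (plant A z) (cs r) t = some T) : ℝ)) +
        ∑ r : Fin R, ∑ A ∈ powersetCard k (univ : Finset (Fin n)), (#((univ : Finset (EdgeVec n)).filter fun z =>
          (∃ T ⊆ A, run (plant A z) (cs r) t = some T) ∧ trialOut (plant A z) (cs r) θ = false) : ℝ) := by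
      rw [sum_comm, ← sum_add_distrib]
      refine sum_le_sum fun A _ => ?_
      exact_mod_cast card_not_detOut_le cs θ A
    linarith [hB cs]
  -- the three averaged sums
  have hconst : ∀ K : ℝ, ∑ _cs : Fin R → Fin t → Fin M → Fin n, K = N ^ R * K := by
    intro K
    rw [sum_const, nsmul_eq_mul, hcs_card]
  have hsum1 : ∑ cs : Fin R → Fin t → Fin M → Fin n, ∑ A ∈ powersetCard k (univ : Finset (Fin n)),
      (#((univ : Finset (EdgeVec n)).filter fun z => ∀ r, ¬ ∃ T ⊆ A, run (plant A z) (cs r) t = some T) : ℝ) ≤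
      C * (P * N ^ R * ((1 - s₀) ^ R + e_b)) := by
    rw [sum_comm]
    calc ∑ A ∈ powersetCard k (univ : Finset (Fin n)), ∑ cs : Fin R → Fin t → Fin M → Fin n,
          (#((univ : Finset (EdgeVec n)).filter fun z => ∀ r, ¬ ∃ T ⊆ A, run (plant A z) (cs r) t = some T) : ℝ)
        ≤ ∑ _A ∈ powersetCard k (univ : Finset (Fin n)), P * N ^ R * ((1 - s₀) ^ R + e_b) := sum_le_sum hD
      _ = C * (P * N ^ R * ((1 - s₀) ^ R + e_b)) := by rw [sum_const, nsmul_eq_mul, hKcard]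
  have hsum2 : ∑ cs : Fin R → Fin t → Fin M → Fin n, ∑ r : Fin R, ∑ A ∈ powersetCard k (univ : Finset (Fin n)),
      (#((univ : Finset (EdgeVec n)).filter fun z =>
        (∃ T ⊆ A, run (plant A z) (cs r) t = some T) ∧ trialOut (plant A z) (cs r) θ = false) : ℝ) ≤
      N ^ R * (R * (C * P * (e₁ + e_h))) := by
    rw [← hconst]
    refine sum_le_sum fun cs _ => ?_
    calc ∑ r : Fin R, ∑ A ∈ powersetCard k (univ : Finset (Fin n)), (#((univ : Finset (EdgeVec n)).filter fun z =>
          (∃ T ⊆ A, run (plant A z) (cs r) t = some T) ∧ trialOut (plant A z) (cs r) θ = false) : ℝ)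
        ≤ ∑ _r : Fin R, C * P * (e₁ + e_h) := sum_le_sum fun r _ => hE (cs r)
      _ = R * (C * P * (e₁ + e_h)) := by rw [sum_const, card_univ, Fintype.card_fin, nsmul_eq_mul]
  have hsplit : ∑ cs : Fin R → Fin t → Fin M → Fin n, (C * P * (R * e₀) +
      (∑ A ∈ powersetCard k (univ : Finset (Fin n)),
        (#((univ : Finset (EdgeVec n)).filter fun z => ∀ r, ¬ ∃ T ⊆ A, run (plant A z) (cs r) t = some T) : ℝ)) +
      ∑ r : Fin R, ∑ A ∈ powersetCard k (univ : Finset (Fin n)), (#((univ : Finset (EdgeVec n)).filter fun z =>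
        (∃ T ⊆ A, run (plant A z) (cs r) t = some T) ∧ trialOut (plant A z) (cs r) θ = false) : ℝ)) =
      N ^ R * (C * P * (R * e₀)) +
      (∑ cs : Fin R → Fin t → Fin M → Fin n, ∑ A ∈ powersetCard k (univ : Finset (Fin n)),
        (#((univ : Finset (EdgeVec n)).filter fun z => ∀ r, ¬ ∃ T ⊆ A, run (plant A z) (cs r) t = some T) : ℝ)) +
      ∑ cs : Fin R → Fin t → Fin M → Fin n, ∑ r : Fin R, ∑ A ∈ powersetCard k (univ : Finset (Fin n)),
        (#((univ : Finset (EdgeVec n)).filter fun z =>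
          (∃ T ⊆ A, run (plant A z) (cs r) t = some T) ∧ trialOut (plant A z) (cs r) θ = false) : ℝ) := by
    rw [sum_add_distrib, sum_add_distrib, hconst]
  have hNR : (0 : ℝ) ≤ N ^ R := pow_nonneg hN0 R
  calc ∑ cs : Fin R → Fin t → Fin M → Fin n, Φ cs
      ≤ ∑ cs : Fin R → Fin t → Fin M → Fin n, (C * P * (R * e₀) +
          (∑ A ∈ powersetCard k (univ : Finset (Fin n)),
            (#((univ : Finset (EdgeVec n)).filter fun z => ∀ r, ¬ ∃ T ⊆ A, run (plant A z) (cs r) t = some T) : ℝ)) +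
          ∑ r : Fin R, ∑ A ∈ powersetCard k (univ : Finset (Fin n)), (#((univ : Finset (EdgeVec n)).filter fun z =>
            (∃ T ⊆ A, run (plant A z) (cs r) t = some T) ∧ trialOut (plant A z) (cs r) θ = false) : ℝ)) :=
        sum_le_sum fun cs _ => hΦle cs
    _ ≤ N ^ R * (C * P * (R * e₀)) + C * (P * N ^ R * ((1 - s₀) ^ R + e_b)) + N ^ R * (R * (C * P * (e₁ + e_h))) := by
        rw [hsplit]; linarith [hsum1, hsum2]
    _ = ∑ _cs : Fin R → Fin t → Fin M → Fin n, C * P * (R * e₀ + (1 - s₀) ^ R + e_b + R * (e₁ + e_h)) := by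
        rw [hconst]; ring

end Summit.PneNP.PneNP.Theorems.MonotoneSuffices.Greedy

namespace Summit.PneNP.PneNP.Theorems.MonotoneSuffices.Greedy

open Finset

/-- Registered sub-goal `greedy_average` of stmt-PneNP-18026 (greedy detector, part 8): the union bound over the
trials, exported verbatim. [folklore] -/
theorem greedy_average :
    ∀ {n t M R : ℕ} (cs : Fin R → Fin t → Fin M → Fin n) (θ : ℕ), #((Finset.univ : Finset (Literature.Probability.RandomGraphs.PlantedClique.EdgeVec n)).filter fun x => Summit.PneNP.PneNP.Theorems.MonotoneSuffices.Greedy.detOut x cs θ = true) ≤ ∑ r : Fin R, #((Finset.univ : Finset (Literature.Probability.RandomGraphs.PlantedClique.EdgeVec n)).filter fun x => Summit.PneNP.PneNP.Theorems.MonotoneSuffices.Greedy.trialOut x (cs r) θ = true) :=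
  fun cs θ => card_detOut_le_sum cs θ

end Summit.PneNP.PneNP.Theorems.MonotoneSuffices.Greedy
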